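import Literature.MathematicalPhysics.QuantumFieldTheory.Balaban1983to89.B6Prop26DivLegKLevelV1L0
import Literature.MathematicalPhysics.QuantumFieldTheory.Balaban1983to89.B6Prop26KLevelAssemblyPadV1L0
import HarnessLib
import Literature.MathematicalPhysics.QuantumFieldTheory.Balaban1983to89.B6Cover236MultiLevelBlocksL0
import Literature.MathematicalPhysics.QuantumFieldTheory.Balaban1983to89.B6Geom246MultiLevelTorusL0
import Literature.MathematicalPhysics.QuantumFieldTheory.Balaban1983to89.B6GlobalChartV1L0
import Literature.MathematicalPhysics.QuantumFieldTheory.Balaban1983to89.B6MultiLevelTorusOperatorL0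
import Literature.MathematicalPhysics.QuantumFieldTheory.Balaban1983to89.B6PadLevelV1L0
import Literature.MathematicalPhysics.QuantumFieldTheory.Balaban1983to89.B8Ineq192MultiLevelTorusL0

/-!
# `Balaban1983to89.B6Prop26DivKLevelPadV1L0` — LEVEL-0 TWIN (programme G-F3′-L0, director-ym LINE №27 / UV3-NODE §24.5; plan `lit-balaban-r03/G-F3L0-PLAN.md`) of `B6Prop26DivKLevelPadV1`:
the same declarations, SAME NAMES AND STATEMENTS, for nested families WITH print's region `Λ₀ = T ∖ Ω₁` ADMITTED (structures
`B6MultiLevelBoxOperatorL0.Domains` / `B6MultiLevelTorusOperatorL0.TDomains`: levels `0, …, k`, the level-`0` block a single site, `Q′₀ = id`,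
finite weight `a₀` — print p.225 (2.14) «Σ_{j=0}^k … (Q′₀λ)(x) = λ(x), x ∈ Λ₀», p.229 «taking a sequence (2.1) … smallest possible domains B^j(Λ_j),
and considering the operator Δ_a defined by (2.19), (2.20) for this sequence»).  Every `D`-free object is the lineage's, consumed BY NAME; no existing
module is touched; no fact is minted.  Unit `lit-balaban-p33` (p33 gen 101; programme RIGHT-ENTRY-L0 = the (2.136)₃ right-factor chain at level 0, the input of [B9] Thm 3.3's right entry (3.42)₃ for the bond-sector cube letter G_□(1), cell GAPS G-B9-02; port tooling by r03 gen 36–37); B6 fold owner r03; referee ref-4.  THE TWIN'S DOCUMENTATION FOLLOWS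
VERBATIM (its «levels 1 … k» / «Ω₁ = X» sentences describe the twin; here `j` runs from `0` and `Ω₁` may be a proper subset).

# `Balaban1983to89.B6Prop26DivKLevelPadV1` — T. Bałaban, *Propagators and renormalization transformations for lattice gauge theories. II*,
# Commun. Math. Phys. **96** (1984) 223–250 [Balaban1984PropagatorsII], Proposition 2.6 p. 247, THE SUP ENTRY (2.136)₃ `|(G∇*J)(x)| ≤ O(1)Lʲη e^{−δ₃d(y,y′)}|J|`
# AT k LEVELS FOR THE GENUINE `G = Δ_a⁻¹` OF THE V1 TORUS — FOR EVERY ODD `L ≥ 5`, `k ≥ 1`, `P′ ≥ 5L`, WITHOUT THE PLACEMENT HYPOTHESIS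
# (p38's `B6Prop26DivLegKLevelV1L0.prop26_2136_div_kLevel` applied at p38's padded family `padT D` of `…B6PadLevelV1`; the `_pad_V1` twin of (2.136)₃,
# sibling of `B6Prop26GradKLevelV1L0.prop26_2136_grad_kLevel_unconditional_pad_V1` ((2.136)₁,₂) and `B6Ineq2140KLevelPadV1` ((2.140)₁))

statement-level skeleton of published theorems with citation tags; proofs where landed; nothing here is a claim about the Yang–Mills mass gap

WHAT IS PRINTED (p. 247 [PDF 25], Proposition 2.6, verbatim up to notation; render
`b2b-balaban-ref1/pages/1984-cmp96-propagators-rt-II/1984-cmp96-propagators-rt-II-p025-x2.png`): *"|(GJ)(x)|, |(∇GJ)(x)|, |(G∇*J)(x)|, |(ΔGJ)(x)| ≤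
O(1)[(Lʲη)², Lʲη, Lʲη, 1] e^{−δ₃d(y,y′)}|J| (2.136) for x ∈ Δ(y), y ∈ Λ_j, supp J ⊂ Δ(y′) … with the constant O(1) depending on d and L."*  The setting is
print's (2.1)–(2.4) p. 224 (the torus `T`, the sequence of domains `Ω_j`, `M_h`, `R`) and (2.16) p. 225 (the weights); print places NO condition on the
position of the top cubes — the placement hypothesis of the tree's k-level assembly (`Placed`, `B6CubeWindowV1`) is an artefact of the cube-window chart
and is removed here exactly as p38 removed it for (2.136)₁,₂ (`B6Prop26KLevelAssemblyPadV1`, `B6Prop26GradKLevelV1` §4).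

CITATION HEADER (lean-in-tree rule) — WHAT IS REPRODUCED.  Phase-2 file of the `lit-balaban` typed skeleton (HOME `run/shared/lean/pub/lit-balaban/`),
seat **p21 gen 30** (free-target protocol; the architecture is p22 gen 24's never-filed READY text `B6Ineq2140GradKLevelPadV1` §1, 2026-08-23, re-built over
the tree as it stands), lane B6 §C (fold owner r03, referee ref-4); SKELETON row **B6.Prop2.6** (member cells only; the head is r03's).  Contents:
* §1 **`prop26_2136_div_kLevel_unconditional`** — p38's `prop26_2136_div_kLevel` (F13 §4: (2.136)₃ with no displayed leg; torus-size thresholds, the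
  Lemma-2.1 budget `e^{−ασ}L^{2(d+1)/N₀} < 1` and the transport condition `2 log L ≤ τ(R·L·M_h − 1)` displayed) RE-PACKAGED in the shape of
  `B6Prop26GradKLevelV1L0.prop26_2136_grad_kLevel_unconditional`: `∃ σ₁ > 0, ∀ σ ∈ (0, σ₁], ∀ α ∈ (0, 1), ∃ A ≥ 0, M₂ > 0` such that on every admissible V1
  torus (`k ≥ 2`, `M_h = Lᵃ ≥ 8`, `R ≥ 2L²`, `P′ ≥ 5`, `L ≥ 5`, every top cube placed) above the ONE threshold `M₂ ≤ L·M_h`, for every `c′ ≠ 0`, positive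
  weights in the global band and every direction `ν`: `HasMajorant (G·∇^{η*}_ν) (A·(L^{j(y)}|c′|⁻¹)·e^{−((1−α)σ/2)d_T(y,y′)})` — the transport budget
  `τ := (1−α)σ`, the Lemma-2.1 integer `N₀ := ⌈2(d+1)log L/(ασ)⌉₊ + 1` and the transport integer `⌈2 log L/τ⌉₊` chosen inside and folded into `M₂`
  (`N + 1 ≤ L·M_h ≤ R·L·M_h`);
* §2 **`prop26_2136_div_kLevel_unconditional_pad_V1`** — THE SAME FOR EVERY ODD `L ≥ 5`, `k ≥ 1`, `P′_μ ≥ 5L`, NO PLACEMENT HYPOTHESIS: §1 applied to the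
  padded family `padT D` (`k + 1` levels, empty bottom level, `P′ = L·P″`; every cube placed — `placed_pad`; literally the same `G` — `SameOm.GE_eq`; the same
  blocks, block map, lengths and distance — `hasMajorant_of_pad`, `dist_eT`), the padding data derived from `P′ ≥ 5L` (`hLP_of_V1`, `hP5_of_V1`, `hk'_of_V1`);
  this is the statement p21's `B9Thm314GFlatV1All` ([B9] Thm 3.14 at `U = 1`, the (2.136)₃ and (2.140)₂,₃ members) consumes BY NAME;
* §3 **`prop26_2136_div_kLevel_census_pad_V1`** — §2 at `σ := σ₁`, `α := ½` in the census shape `∃ δ > 0, A ≥ 0, M₂ > 0` (one rate, one constant, one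
  threshold; `∘ₗ` form), the no-placement companion of F13 §5 `prop26_2136_div_kLevel_census`.
All theorems, proved, 0 sorry, no definition, no `def … : Prop`; standard axioms; imports BY NAME, restating nothing.

HONEST SCOPE / DIVERGENCES.  (1) As F13: `η = |c′|⁻¹`, `Lʲ = (geomT D).len y` read at the OUTPUT block, unweighted kernels, constants and rates ours (on
`d, L, b₀, b₁`); print's `δ₃` is not quantified beyond `∃`.  (2) V1 torus with `M_h = Lᵃ ≥ 8`, `R ≥ 2L²`, odd `L ≥ 5`; §1 keeps `k ≥ 2`, `P′ ≥ 5` and the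
placement of the top cubes, §2–§3 have `k ≥ 1`, `P′_μ ≥ 5L` and nothing per cube.  (3) `L = 3` is NOT covered (the cube-window chart needs `L ≥ 5`; the
`…L3` lineage of 2026-08-27 treats `L = 3` for the k-level family with level-0 sites, not this file).  Nothing on d = 4 specifically or the continuum; NOT
summit progress.  Unit `lit-balaban-p21` (gen 30), 2026-08-27.
-/

noncomputable section

open scoped BigOperators
open Finset

namespace Literature.MathematicalPhysics.QuantumFieldTheory.Balaban1983to89.B6Prop26DivKLevelPadV1L0

open B6MultiLevelBoxOperator (N0)
open B6MultiLevelTorusOperatorL0 (TDomains)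
open B6Cover236MultiLevelBlocksL0 (cubes)
open B6Geom246MultiLevelTorusL0 (geomT)
open B8Ineq192MultiLevelTorusL0 (geomTB geomTB_len geomT_len)
open B6RandomWalk (HasMajorant hasMajorant_mono)
open B6Ineq2133TwoScaleV1 (onFun)
open B6GlobalChartV1 (PV)
open B6GlobalChartV1L0 (domT blkV1)
open B6SectAOperatorsV1 (BondIdx)
open B6SectAVectorModelV1 (GE)
open B6CubeWindowV1 (Placed GlobalBand)
open B6LapLegKLevelV1 (DVa)
open B6PadLevelV1 (hN_pad)
open B6PadLevelV1L0 (padT placed_pad sameOm_domT_pad eT dist_eT hasMajorant_of_pad globalBand_pad)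
open B6Prop26KLevelAssemblyPadV1 (hLP_of_V1 hP5_of_V1 hk'_of_V1)
open B6Prop26DivLegKLevelV1L0 (prop26_2136_div_kLevel)

/-! ## §0  Arithmetic of the thresholds (private, re-proved as in the sibling files) -/

/-- the budget inequality `e^{−ασ}·L^{2(d+1)/N₀} < 1` for `N₀ := ⌈2(d+1)·log L/(ασ)⌉₊ + 1` (`α, σ > 0`). [folklore] -/
private theorem budget_lt_one {d ℓ : ℕ} {α σ : ℝ} (hα : 0 < α) (hσ : 0 < σ) :
    Real.exp (-(α * σ)) * ((ℓ : ℝ) + 1) ^ ((2 * (d + 1 : ℕ) : ℝ) / (⌈2 * ((d : ℝ) + 1) * Real.log ((ℓ : ℝ) + 1) / (α * σ)⌉₊ + 1 : ℕ)) < 1 := by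
  have hL : (0 : ℝ) < (ℓ : ℝ) + 1 := by positivity
  have hlog : 0 ≤ Real.log ((ℓ : ℝ) + 1) := Real.log_nonneg (by linarith [(Nat.cast_nonneg ℓ : (0 : ℝ) ≤ ℓ)])
  have hN : 2 * ((d : ℝ) + 1) * Real.log ((ℓ : ℝ) + 1) / (α * σ) <
      ((⌈2 * ((d : ℝ) + 1) * Real.log ((ℓ : ℝ) + 1) / (α * σ)⌉₊ + 1 : ℕ) : ℝ) := by
    push_cast
    exact lt_of_le_of_lt (Nat.le_ceil _) (lt_add_one _)
  have hNpos : (0 : ℝ) < ((⌈2 * ((d : ℝ) + 1) * Real.log ((ℓ : ℝ) + 1) / (α * σ)⌉₊ + 1 : ℕ) : ℝ) := by positivity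
  have hασ : 0 < α * σ := mul_pos hα hσ
  have key : (2 * (d + 1 : ℕ) : ℝ) / (⌈2 * ((d : ℝ) + 1) * Real.log ((ℓ : ℝ) + 1) / (α * σ)⌉₊ + 1 : ℕ) * Real.log ((ℓ : ℝ) + 1) < α * σ := by
    rw [div_mul_eq_mul_div, div_lt_iff₀ hNpos]
    rw [div_lt_iff₀ hασ] at hN
    push_cast at hN ⊢
    nlinarith
  rw [Real.rpow_def_of_pos hL, ← Real.exp_add, Real.exp_lt_one_iff]
  nlinarith

/-- the transport condition `2 log L ≤ τ·(R·L·M_h − 1)` from `⌈2 log L/τ⌉₊ ≤ N` and `N + 1 ≤ R·L·M_h` (`τ > 0`). [folklore] -/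
private theorem transport_of_le {ℓ Mh R N : ℕ} {τ : ℝ} (hτ : 0 < τ) (hN : ⌈2 * Real.log ((ℓ : ℝ) + 1) / τ⌉₊ ≤ N)
    (hRM : N + 1 ≤ R * ((ℓ + 1) * Mh)) : 2 * Real.log ((ℓ : ℝ) + 1) ≤ τ * (((R * ((ℓ + 1) * Mh) - 1 : ℕ)) : ℝ) := by
  have h1 : 2 * Real.log ((ℓ : ℝ) + 1) / τ ≤ (N : ℝ) := (Nat.le_ceil _).trans (by exact_mod_cast hN)
  have h2 : (N : ℝ) ≤ (((R * ((ℓ + 1) * Mh) - 1 : ℕ)) : ℝ) := by exact_mod_cast (by omega : N ≤ R * ((ℓ + 1) * Mh) - 1)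
  rw [div_le_iff₀ hτ] at h1
  nlinarith

/-- a natural-number threshold folded into the real threshold `M₂ ≤ L·M_h`: `N + 1 ≤ L·M_h ≤ R·L·M_h` (`R ≥ 2L² ≥ 1`). [folklore] -/
private theorem hRM_of_le {ℓ Mh R N : ℕ} (hR2 : 2 * (ℓ + 1) ^ 2 ≤ R) (h : ((N : ℕ) : ℝ) + 1 ≤ ((ℓ : ℝ) + 1) * Mh) :
    N + 1 ≤ R * ((ℓ + 1) * Mh) := by
  have h2 : N + 1 ≤ (ℓ + 1) * Mh := by exact_mod_cast h
  have hR1 : 1 ≤ R := le_trans (by nlinarith [Nat.zero_le ℓ]) hR2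
  calc N + 1 ≤ (ℓ + 1) * Mh := h2
    _ = 1 * ((ℓ + 1) * Mh) := (one_mul _).symm
    _ ≤ R * ((ℓ + 1) * Mh) := Nat.mul_le_mul_right _ hR1

/-! ## §1  (2.136)₃ for the genuine k-level `G`, the thresholds chosen inside (placement kept) -/

section Placed

open Classical in
/-- **PROPOSITION 2.6, ENTRY (2.136)₃ `|(G∇*J)(x)| ≤ O(1)Lʲη e^{−δ₃d(y,y′)}|J|` AT k LEVELS FOR THE GENUINE `G = Δ_a⁻¹` OF THE V1 TORUS — NO DISPLAYED
ANALYTIC HYPOTHESIS, ONE THRESHOLD** (p38's `B6Prop26DivLegKLevelV1L0.prop26_2136_div_kLevel` with the transport budget `τ := (1−α)σ`, the Lemma-2.1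
integer and the transport integer chosen inside): for every weight band `[b₀, b₁]` there is `σ₁ > 0` such that for all `0 < σ ≤ σ₁`, `0 < α < 1` there are
`A ≥ 0`, `M₂ > 0` with: on every V1 global torus with `k ≥ 2`, `M_h = Lᵃ ≥ 8`, `R ≥ 2L²`, `P′ ≥ 5`, `L ≥ 5`, all top cubes placed, `M₂ ≤ L·M_h`, for every
`c′ ≠ 0`, positive weights in the band and every direction `ν`: `HasMajorant (G·∇^{η*}_ν) (A·(L^{j(y)}·|c′|⁻¹)·e^{−((1−α)σ/2)d_T(y,y′)})` — print's
`x ∈ B^j(y)`, `J ∈ A(B(y′))`, `η = |c′|⁻¹`.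
[cite: Balaban1984PropagatorsII, Prop. 2.6 (2.136) p.247 (third entry), (2.141) p.247, (2.133)–(2.135) p.247, (2.88)–(2.94) pp.238–239, Lemma 2.1 p.234] -/
theorem prop26_2136_div_kLevel_unconditional (d ℓ : ℕ) (hd : 1 ≤ d + 1) (hL : Odd (ℓ + 1) ∧ 1 < ℓ + 1) {b₀ b₁ : ℝ} (hb₀ : 0 < b₀)
    (hb₁ : b₀ ≤ b₁) :
    ∃ σ₁ : ℝ, 0 < σ₁ ∧ ∀ (σ : ℝ), 0 < σ → σ ≤ σ₁ → ∀ (α : ℝ), 0 < α → α < 1 →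
    ∃ A M₂ : ℝ, 0 ≤ A ∧ 0 < M₂ ∧
    ∀ (m K : ℕ) {Mh k R : ℕ} {P' : Fin (d + 1) → ℕ}
      (hN : ∀ μ, N0 ℓ Mh k P' μ = (PV d ℓ m K hd hL).sitesPerDir 0) (D : B6MultiLevelTorusOperatorL0.TDomains d ℓ Mh k P' R) (hk : k ≤ m + K) (_ : 2 ≤ k)
      {a : ℕ} (_ : Mh = (ℓ + 1) ^ a) (_ : 8 ≤ Mh) (_ : 2 * (ℓ + 1) ^ 2 ≤ R) (_ : ∀ μ, 5 ≤ P' μ) (_ : 4 ≤ ℓ)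
      (_ : ∀ c : ↥(cubes D.toDomains), Placed ℓ k P' c.1) (_ : M₂ ≤ ((ℓ : ℝ) + 1) * Mh)
      {cf : ℝ} (hcf : cf ≠ 0) {w : BondIdx (domT hN D hk) → ℝ} (hw : ∀ i, 0 < w i) (_ : GlobalBand b₀ b₁ cf w) (ν : Fin (d + 1)),
      HasMajorant (g := geomT D) (blkV1 hN D) (onFun (GE (domT hN D hk) hcf hw) * DVa ν cf)
        (fun y y' => A * ((geomT D).len y * |cf|⁻¹) * Real.exp (-((1 - α) * σ / 2 * (geomT D).dist y y'))) := by
  obtain ⟨σ₀, hσ₀, h⟩ := prop26_2136_div_kLevel d ℓ hd hL hb₀ hb₁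
  refine ⟨σ₀, hσ₀, fun σ hσ hσ1 α hα hα1 => ?_⟩
  have hτ0 : 0 ≤ (1 - α) * σ := mul_nonneg (by linarith) hσ.le
  have hτ : 0 < (1 - α) * σ := mul_pos (by linarith) hσ
  have hτ2 : (1 - α) * σ ≤ 2 * σ := by nlinarith
  obtain ⟨A, M₁, hA, hM₁, h2⟩ := h σ hσ hσ1 α hα.le hα1.le
    (⌈2 * ((d : ℝ) + 1) * Real.log ((ℓ : ℝ) + 1) / (α * σ)⌉₊ + 1) (Nat.succ_pos _) (τ := (1 - α) * σ) hτ0 hτ2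
  refine ⟨A, max M₁ (max (((⌈2 * ((d : ℝ) + 1) * Real.log ((ℓ : ℝ) + 1) / (α * σ)⌉₊ + 1 : ℕ) : ℝ) + 1)
    (((⌈2 * Real.log ((ℓ : ℝ) + 1) / ((1 - α) * σ)⌉₊ : ℕ) : ℝ) + 1)), hA, lt_max_of_lt_left hM₁, ?_⟩
  intro m K Mh k R P' hN D hk hk2 a hMha hM8 hR2 hP5 hℓ hpl hM cf hcf w hw hwb ν
  have hM1 : M₁ ≤ ((ℓ : ℝ) + 1) * Mh := (le_max_left _ _).trans hM
  have hRM0 := hRM_of_le hR2 (((le_max_left _ _).trans (le_max_right _ _)).trans hM)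
  have hRM1 := hRM_of_le hR2 (((le_max_right _ _).trans (le_max_right _ _)).trans hM)
  have hθ := budget_lt_one (d := d) (ℓ := ℓ) hα hσ
  have hτ' := transport_of_le (Mh := Mh) (R := R) hτ le_rfl hRM1
  have hx := h2 m K hN D hk hk2 hMha hM8 hR2 hP5 hℓ hpl hM1 hRM0 hθ hτ' hcf hw hwb ν
  refine hasMajorant_mono _ hx fun y y' => le_of_eq ?_
  rw [show ((1 : ℝ) - α) * σ - (1 - α) * σ / 2 = (1 - α) * σ / 2 by ring, geomTB_len, geomT_len]

end Placed

/-! ## §2  (2.136)₃ for every odd `L ≥ 5`, `k ≥ 1`, no placement hypothesis -/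

section Pad

open Classical in
/-- **PROPOSITION 2.6, ENTRY (2.136)₃ `|(G∇*J)(x)| ≤ O(1)Lʲη e^{−δ₃d(y,y′)}|J|` AT k LEVELS FOR THE GENUINE `G`, EVERY ODD `L ≥ 5`, `k ≥ 1`, NO PLACEMENT
HYPOTHESIS** (`P′_μ ≥ 5L`; §1 applied to the padded family `padT D`, which places every cube and has the same `G`, blocks and distance): for every weight
band `[b₀, b₁]` there is `σ₁ > 0` such that for all `0 < σ ≤ σ₁`, `0 < α < 1` there are `A ≥ 0`, `M₂ > 0` with: on every V1 global torus with `k ≥ 1`,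
`M_h = Lᵃ ≥ 8`, `M₂ ≤ L·M_h`, `R ≥ 2L²`, `P′ ≥ 5L`, `L ≥ 5`, for `c′ ≠ 0`, weights in the band and every direction `ν`:
`HasMajorant (G·∇^{η*}_ν) (A·(Lʲ⁽ʸ⁾·|c′|⁻¹)·e^{−((1−α)σ/2)d_T(y,y′)})`.
[cite: Balaban1984PropagatorsII, Prop. 2.6 (2.136) p.247 (third entry), (2.141) p.247, (2.1)–(2.4) p.224, (2.16) p.225, Lemma 2.1 p.234] -/
theorem prop26_2136_div_kLevel_unconditional_pad_V1 (d ℓ : ℕ) (hd : 1 ≤ d + 1) (hL : Odd (ℓ + 1) ∧ 1 < ℓ + 1) {b₀ b₁ : ℝ} (hb₀ : 0 < b₀)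
    (hb₁ : b₀ ≤ b₁) :
    ∃ σ₁ : ℝ, 0 < σ₁ ∧ ∀ (σ : ℝ), 0 < σ → σ ≤ σ₁ → ∀ (α : ℝ), 0 < α → α < 1 →
    ∃ A M₂ : ℝ, 0 ≤ A ∧ 0 < M₂ ∧
    ∀ (m K : ℕ) {Mh k R : ℕ} {P' : Fin (d + 1) → ℕ}
      (hN : ∀ μ, N0 ℓ Mh k P' μ = (PV d ℓ m K hd hL).sitesPerDir 0) (D : B6MultiLevelTorusOperatorL0.TDomains d ℓ Mh k P' R) (hk : k ≤ m + K) (_ : 1 ≤ k)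
      {a : ℕ} (_ : Mh = (ℓ + 1) ^ a) (_ : 8 ≤ Mh) (_ : 2 * (ℓ + 1) ^ 2 ≤ R) (_ : ∀ μ, 5 * (ℓ + 1) ≤ P' μ) (_ : 4 ≤ ℓ)
      (_ : M₂ ≤ ((ℓ : ℝ) + 1) * Mh)
      {cf : ℝ} (hcf : cf ≠ 0) {w : BondIdx (domT hN D hk) → ℝ} (hw : ∀ i, 0 < w i) (_ : GlobalBand b₀ b₁ cf w) (ν : Fin (d + 1)),
      HasMajorant (g := geomT D) (blkV1 hN D) (onFun (GE (domT hN D hk) hcf hw) * DVa ν cf)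
        (fun y y' => A * ((geomT D).len y * |cf|⁻¹) * Real.exp (-((1 - α) * σ / 2 * (geomT D).dist y y'))) := by
  obtain ⟨σ₁, hσ₁, h⟩ := prop26_2136_div_kLevel_unconditional d ℓ hd hL hb₀ hb₁
  refine ⟨σ₁, hσ₁, fun σ hσ hσ1 α hα hα1 => ?_⟩
  obtain ⟨A, M₂, hA, hM₂, h2⟩ := h σ hσ hσ1 α hα hα1
  refine ⟨A, M₂, hA, hM₂, ?_⟩
  intro m K Mh k R P' hN D hk hk1 a hMha hM8 hR2 hP hℓ hM cf hcf w hw hwb ν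
  have hLP := hLP_of_V1 hN hMha hP
  have hk' := hk'_of_V1 hN hMha hP
  have hS := sameOm_domT_pad hN D hk hLP hk'
  have hw' : ∀ i, 0 < (w ∘ hS.idxB) i := fun i => hw _
  -- (2.136)₃ for the padded family (`k + 1` levels, every cube placed)
  have hpad := h2 m K (hN_pad hN hLP) (padT D hLP) hk' (by omega) hMha hM8 hR2 (hP5_of_V1 hP) hℓ (placed_pad D hLP (hP5_of_V1 hP)) hM hcf hw'
    (globalBand_pad D hLP hN hk hk' hwb) ν
  -- literally the same `G`
  rw [hS.GE_eq hcf hw hw'] at hpad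
  -- the same blocks, block map, distance and lengths
  have hK : (fun a b : (geomT D).Site => A * ((geomT (padT D hLP)).len (eT D hLP a) * |cf|⁻¹) *
      Real.exp (-((1 - α) * σ / 2 * (geomT (padT D hLP)).dist (eT D hLP a) (eT D hLP b)))) =
      fun y y' => A * ((geomT D).len y * |cf|⁻¹) * Real.exp (-((1 - α) * σ / 2 * (geomT D).dist y y')) := by
    funext a b
    rw [dist_eT, geomT_len, geomT_len]
    rfl
  rw [← hK]
  exact hasMajorant_of_pad D hLP hN hpad

end Pad

/-! ## §3  The census shape, no placement hypothesis -/

section Census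

open Classical in
/-- **PROPOSITION 2.6 (2.136)₃ AT k LEVELS FOR THE GENUINE `G`, CENSUS SHAPE, EVERY ODD `L ≥ 5`, `k ≥ 1`, NO PLACEMENT HYPOTHESIS** — ONE rate `δ > 0`,
ONE constant `A` and ONE torus-size threshold `M₂` chosen once for the weight band: on every V1 global torus (`k ≥ 1`, `M_h = Lᵃ ≥ 8`, `R ≥ 2L²`,
`P′_μ ≥ 5L`, `L ≥ 5`) with `M₂ ≤ L·M_h`, for every `c′ ≠ 0`, positive weights in the global band and every direction `ν`:
`HasMajorant (G ∘ ∇^{η*}_ν) (A·(L^{j(y)}|c′|⁻¹)·e^{−δ d_T(y,y′)})` — print's `|(G∇*J)(x)| ≤ O(1)Lʲη e^{−δ₃d(y,y′)}|J|`, `x ∈ B^j(y)`, `J ∈ A(B(y′))`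
(§2 at `σ := σ₁`, `α := ½`, rate `δ = σ₁/4`).
[cite: Balaban1984PropagatorsII, Prop. 2.6 (2.136) p.247 (third entry), (2.141) p.247, (2.1)–(2.4) p.224, (2.16) p.225, Lemma 2.1 p.234] -/
theorem prop26_2136_div_kLevel_census_pad_V1 (d ℓ : ℕ) (hd : 1 ≤ d + 1) (hL : Odd (ℓ + 1) ∧ 1 < ℓ + 1) {b₀ b₁ : ℝ} (hb₀ : 0 < b₀)
    (hb₁ : b₀ ≤ b₁) :
    ∃ δ A M₂ : ℝ, 0 < δ ∧ 0 ≤ A ∧ 0 < M₂ ∧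
      ∀ (m K : ℕ) {Mh k R : ℕ} {P' : Fin (d + 1) → ℕ}
        (hN : ∀ μ, N0 ℓ Mh k P' μ = (PV d ℓ m K hd hL).sitesPerDir 0) (D : B6MultiLevelTorusOperatorL0.TDomains d ℓ Mh k P' R) (hk : k ≤ m + K) (_ : 1 ≤ k)
        {a : ℕ} (_ : Mh = (ℓ + 1) ^ a) (_ : 8 ≤ Mh) (_ : 2 * (ℓ + 1) ^ 2 ≤ R) (_ : ∀ μ, 5 * (ℓ + 1) ≤ P' μ) (_ : 4 ≤ ℓ)
        (_ : M₂ ≤ ((ℓ : ℝ) + 1) * Mh)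
        {cf : ℝ} (hcf : cf ≠ 0) {w : BondIdx (domT hN D hk) → ℝ} (hw : ∀ i, 0 < w i) (_ : GlobalBand b₀ b₁ cf w) (ν : Fin (d + 1)),
        HasMajorant (g := geomT D) (blkV1 hN D) (onFun (GE (domT hN D hk) hcf hw) ∘ₗ DVa ν cf)
          (fun y y' => A * ((geomT D).len y * |cf|⁻¹) * Real.exp (-(δ * (geomT D).dist y y'))) := by
  obtain ⟨σ₁, hσ₁, h⟩ := prop26_2136_div_kLevel_unconditional_pad_V1 d ℓ hd hL hb₀ hb₁
  obtain ⟨A, M₂, hA, hM₂, h2⟩ := h σ₁ hσ₁ le_rfl (1 / 2) (by norm_num) (by norm_num)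
  refine ⟨(1 - 1 / 2) * σ₁ / 2, A, M₂, by norm_num [hσ₁], hA, hM₂, ?_⟩
  intro m K Mh k R P' hN D hk hk1 a hMha hM8 hR2 hP hℓ hM cf hcf w hw hwb ν
  exact h2 m K hN D hk hk1 hMha hM8 hR2 hP hℓ hM hcf hw hwb ν

end Census

end Literature.MathematicalPhysics.QuantumFieldTheory.Balaban1983to89.B6Prop26DivKLevelPadV1L0
end
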